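import Literature.NumberTheory.GaloisRepresentations.IdeleInflation
import HarnessLib

/-!
# The semi-local modules in a tower `F ⊆ E ⊆ E'`: `∏_{w∣v} E_w → ∏_{w'∣v} E'_{w'}` as a morphism of pairs over
# `res : Gal(E'/F) → Gal(E/F)`, and its compatibility with the place projections of `J_E → J_{E'}`
# (Tate, C–F VII §1.1, §7.2–§7.3)

Topic `NumberTheory/GaloisRepresentations`; namespaces `Literature.NumberTheory.GaloisRepresentations.SemiLocal` (§1–§3) and
`….IdeleCohomology` (§4).  Continues `IdeleInflation.lean` (`ideleInflHom : Res_{res} J_E ⟶ J_{E'}`, `ideleInf n`) and the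
place-level files `SemiLocalUnits.lean` (`SemiLocal F E v = ∏_{w∣v} E_w`, `Place F E v`), `IdeleCohomologyLimit.lean`
(`placeProj v : J_E ⟶ ∏_{w∣v} E_wˣ`), with the tree's local base change `adicCompletionOfUnder (𝓞 E) E E' w' : E_w → E'_{w'}`
(`w = w' ∩ E`, `Automorphic/AdeleBaseChange`) and its Galois equivariance `galAdicCompletionMap_comp_adicCompletionOfUnder_tower`
(`Automorphic/IdeleNormTowerProofs`).  Definitions with bodies (`Place.below`, `inflMap`, `inflRepHom`, `semiLocalInf`) and
theorems; NO named fact, no `sorry`, no instance, no notation; number fields in `Type`.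

Mathematics.  For `w' ∣ v` a place of `E'` and `w = w' ∩ E` the place of `E` below it, the inclusions `E_w ⊆ E'_{w'}`
assemble to `ι_v : ∏_{w∣v} E_w → ∏_{w'∣v} E'_{w'}`, `(ι_v x)_{w'} = x_{w'∩E}`, which is `Gal(E'/F)`-equivariant through
`res` (`τ_{w'} ∘ (E_w ⊆ E'_{τ⁻¹w'}) = (E_{σ w} ⊆ E'_{w'}) ∘ σ_w`, `σ = τ|_E`; Tate VII §1.1) and is the `v`-block of the base
change of idèles `J_E → J_{E'}` (Tate VII §7.3: the decomposition `J_{L,S} = ∏ …` is functorial in `L`).  Hence the inflation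
`Hⁿ(Gal(E/F), J_E) → Hⁿ(Gal(E'/F), J_{E'})` is compatible with the place projections: §4 `map_placeProj_ideleInf`.

## What is formalised

* §1 `Place.below w' : Place F E v` (`w' ∩ E`), `Place.coe_below`, `Place.below_smul` (`(τw') ∩ E = τ|_E (w' ∩ E)`).
* §2 `inflMap E E' v : SemiLocal F E v →+* SemiLocal F E' v`, `inflMap_apply`, **`smul_inflMap`** (equivariance over `res`).
* §3 `inflRepHom : Res_{res}(∏_{w∣v} E_wˣ) ⟶ ∏_{w'∣v} E'_{w'}ˣ` in `Rep ℤ Gal(E'/F)`, `coe_toMul_inflRepHom_apply`,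
  **`res_placeProj_comp_inflRepHom`** (the `v`-block of `ideleInflHom`).
* §4 `IdeleCohomology.semiLocalInf v n = Hⁿ(res, ι_v)`, **`IdeleCohomology.map_placeProj_ideleInf`**:
  `Hⁿ(placeProj_{E'} v) (Inf c) = semiLocalInf v n (Hⁿ(placeProj_E v) c)`.

## References
* J. W. S. Cassels, A. Fröhlich (eds.), *Algebraic Number Theory* (1967), Ch. VII (Tate) §1.1, §7.2–§7.3; Ch. II §10.
  [CasselsFrohlichANT1967]
-/

noncomputable section

open NumberField IsDedekindDomain CategoryTheory groupCohomology
open Literature.NumberTheory.Automorphic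

namespace Literature.NumberTheory.GaloisRepresentations

namespace SemiLocal

open Literature.Algebra.Homology

variable {F E E' : Type} [Field F] [NumberField F] [Field E] [NumberField E] [Field E'] [NumberField E']
  [Algebra F E] [Algebra E E'] [Algebra F E'] [IsScalarTower F E E']
variable {v : HeightOneSpectrum (𝓞 F)}

/-! ## §1. The place of `E` below a place of `E'` -/

/-- **`w' ∩ E`**: the place of `E` below the place `w' ∣ v` of `E'` (still above `v`: `(w' ∩ E) ∩ F = w' ∩ F = v`).
[cite: CasselsFrohlichANT1967, Ch. II §10] -/
def Place.below (w' : Place F E' v) : Place F E v :=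
  ⟨(w' : HeightOneSpectrum (𝓞 E')).under (𝓞 E), by
    rw [HeightOneSpectrum.under_under F E E']
    exact w'.under_eq⟩

omit [NumberField F] [NumberField E] [NumberField E'] in
/-- Unfolding `Place.below`. [cite: CasselsFrohlichANT1967, Ch. II §10] -/
@[simp] theorem Place.coe_below (w' : Place F E' v) :
    ((Place.below w' : Place F E v) : HeightOneSpectrum (𝓞 E)) = (w' : HeightOneSpectrum (𝓞 E')).under (𝓞 E) := rfl

/-- **`(τ w') ∩ E = τ|_E (w' ∩ E)`** for `τ ∈ Gal(E'/F)` (the tree's `HeightOneSpectrum.under_tower_smul`).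
[cite: CasselsFrohlichANT1967, Ch. VII §1.1] -/
theorem Place.below_smul [Normal F E] (τ : E' ≃ₐ[F] E') (w' : Place F E' v) :
    Place.below (τ • w') = (τ.restrictNormal E • Place.below w' : Place F E v) :=
  Place.ext (HeightOneSpectrum.under_tower_smul τ _)

/-- `(τ⁻¹ w') ∩ E = (τ|_E)⁻¹ (w' ∩ E)`. [cite: CasselsFrohlichANT1967, Ch. VII §1.1] -/
theorem Place.below_inv_smul [Normal F E] (τ : E' ≃ₐ[F] E') (w' : Place F E' v) :
    Place.below (τ⁻¹ • w') = ((τ.restrictNormal E)⁻¹ • Place.below w' : Place F E v) := by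
  rw [Place.below_smul]
  exact congrArg (· • Place.below w') (map_inv (AlgEquiv.restrictNormalHom E) τ)

/-! ## §2. `ι_v : ∏_{w∣v} E_w → ∏_{w'∣v} E'_{w'}` and its equivariance -/

variable (E E' v) in
/-- **`ι_v : ∏_{w∣v} E_w →+* ∏_{w'∣v} E'_{w'}`, `(ι_v x)_{w'} = x_{w'∩E}` read in `E'_{w'} ⊇ E_{w'∩E}`** (componentwise the
tree's `adicCompletionOfUnder`). [cite: CasselsFrohlichANT1967, Ch. VII §7.3] -/
def inflMap : SemiLocal F E v →+* SemiLocal F E' v :=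
  RingHom.pi fun w' : Place F E' v =>
    (adicCompletionOfUnder (𝓞 E) E E' (w' : HeightOneSpectrum (𝓞 E'))).comp
      (Pi.evalRingHom (fun w : Place F E v => (w : HeightOneSpectrum (𝓞 E)).adicCompletion E) (Place.below w'))

omit [NumberField F] in
/-- Components of `inflMap`. [cite: CasselsFrohlichANT1967, Ch. VII §7.3] -/
theorem inflMap_apply (x : SemiLocal F E v) (w' : Place F E' v) :
    inflMap E E' v x w' = adicCompletionOfUnder (𝓞 E) E E' (w' : HeightOneSpectrum (𝓞 E')) (x (Place.below w')) := rfl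

omit [NumberField F] in
/-- Pointwise form of the tree's `galAdicCompletionMap_comp_adicCompletionOfUnder_tower`, for `τ W₁ = W`:
`τ_{W₁→W} ∘ (E_{W₁∩E} ⊆ E'_{W₁}) = (E_{W∩E} ⊆ E'_W) ∘ (τ|_E)_{W₁∩E → W∩E}`. [cite: CasselsFrohlichANT1967, Ch. VII §1.1] -/
theorem galAdicCompletionMap_adicCompletionOfUnder [Normal F E] (τ : E' ≃ₐ[F] E') {W₁ W : HeightOneSpectrum (𝓞 E')}
    (hW : τ • W₁ = W) (hh : τ.restrictNormal E • W₁.under (𝓞 E) = W.under (𝓞 E))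
    (y : (W₁.under (𝓞 E)).adicCompletion E) :
    galAdicCompletionMap τ hW (adicCompletionOfUnder (𝓞 E) E E' W₁ y) =
      adicCompletionOfUnder (𝓞 E) E E' W (galAdicCompletionMap (τ.restrictNormal E) hh y) := by
  obtain rfl : W₁ = τ⁻¹ • W := eq_inv_smul_iff.mpr hW
  exact congrFun (galAdicCompletionMap_comp_adicCompletionOfUnder_tower (K := F) (K' := E) τ W hh) y

/-- `(τ|_E) • ((τ⁻¹ w') ∩ E) = w' ∩ E` on places of `E`. [cite: CasselsFrohlichANT1967, Ch. VII §1.1] -/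
theorem restrictNormal_smul_under_inv_smul [Normal F E] (τ : E' ≃ₐ[F] E') (w' : Place F E' v) :
    τ.restrictNormal E • ((τ⁻¹ • w' : Place F E' v) : HeightOneSpectrum (𝓞 E')).under (𝓞 E) =
      (w' : HeightOneSpectrum (𝓞 E')).under (𝓞 E) := by
  have h := congrArg (fun p : Place F E v => (p : HeightOneSpectrum (𝓞 E))) (Place.below_inv_smul τ w')
  change ((τ⁻¹ • w' : Place F E' v) : HeightOneSpectrum (𝓞 E')).under (𝓞 E) =
    (τ.restrictNormal E)⁻¹ • (w' : HeightOneSpectrum (𝓞 E')).under (𝓞 E) at h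
  rw [h, smul_inv_smul]

/-- **`ι_v` is `Gal(E'/F)`-equivariant through `res`**: `τ • ι_v(x) = ι_v((τ|_E) • x)`
(`τ_{w'} ∘ (E_w ⊆ E'_{τ⁻¹w'}) = (E ⊆ E')_{w'} ∘ (τ|_E)_w`). [cite: CasselsFrohlichANT1967, Ch. VII §1.1] -/
theorem smul_inflMap [Normal F E] (τ : E' ≃ₐ[F] E') (x : SemiLocal F E v) :
    τ • inflMap E E' v x = inflMap E E' v (τ.restrictNormal E • x) := by
  funext w'
  rw [smul_apply, inflMap_apply, inflMap_apply, smul_apply,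
    galAdicCompletionMap_adicCompletionOfUnder τ (Place.smul_coe_inv_smul τ w') (restrictNormal_smul_under_inv_smul τ w')]
  exact congrArg (adicCompletionOfUnder (𝓞 E) E E' (w' : HeightOneSpectrum (𝓞 E')))
    (galAdicCompletionMap_congr_place (w₁ := Place.below (τ⁻¹ • w'))
      (w₂ := (τ.restrictNormal E)⁻¹ • Place.below w') (w := Place.below w') (Place.below_inv_smul τ w') _ _ x)

/-! ## §3. `ι_v` on units, as a morphism of `Gal(E'/F)`-modules; the `v`-block of `J_E → J_{E'}` -/

variable (E E' v) in
/-- **`ι_v : Res_{res}(∏_{w∣v} E_wˣ) ⟶ ∏_{w'∣v} E'_{w'}ˣ` in `Rep ℤ Gal(E'/F)`** (`unitsRep`, additively).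
[cite: CasselsFrohlichANT1967, Ch. VII §7.3] -/
def inflRepHom [Normal F E] : Rep.res (AlgEquiv.restrictNormalHom E) (unitsRep F E v) ⟶ unitsRep F E' v :=
  Rep.ofHom (LinearMap.intertwiningMap_of_isIntertwiningMap _ _
    (MonoidHom.toAdditive (Units.map (inflMap E E' v).toMonoidHom)).toIntLinearMap fun τ x => by
      apply (Additive.toMul (α := (SemiLocal F E' v)ˣ)).injective
      refine Units.ext ?_
      change inflMap E E' v (((τ.restrictNormal E) • (Additive.toMul x : (SemiLocal F E v)ˣ) :
          (SemiLocal F E v)ˣ) : SemiLocal F E v) =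
        τ • inflMap E E' v ((Additive.toMul x : (SemiLocal F E v)ˣ) : SemiLocal F E v)
      exact (congrArg (inflMap E E' v) (val_smul_units _ _)).trans (smul_inflMap τ _).symm)

/-- Components of `inflRepHom` on values. [cite: CasselsFrohlichANT1967, Ch. VII §7.3] -/
theorem coe_toMul_inflRepHom_apply [Normal F E] (x : Additive (SemiLocal F E v)ˣ) (w' : Place F E' v) :
    ((Additive.toMul ((inflRepHom E E' v).hom x) : (SemiLocal F E' v)ˣ) : SemiLocal F E' v) w' =
      adicCompletionOfUnder (𝓞 E) E E' (w' : HeightOneSpectrum (𝓞 E'))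
        (((Additive.toMul x : (SemiLocal F E v)ˣ) : SemiLocal F E v) (Place.below w')) := rfl

/-- **`ι_v` is the `v`-block of the base change of idèles**: `placeProj_{E'} v ∘ (J_E → J_{E'}) = ι_v ∘ placeProj_E v`
(as morphisms of `Gal(E'/F)`-modules). [cite: CasselsFrohlichANT1967, Ch. VII §7.3] -/
theorem res_placeProj_comp_inflRepHom [Normal F E] :
    (Rep.resFunctor (AlgEquiv.restrictNormalHom E)).map (IdeleCohomology.placeProj (E := E) v) ≫ inflRepHom E E' v =
      IdeleCohomology.ideleInflHom F E E' ≫ IdeleCohomology.placeProj (E := E') v := by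
  refine Rep.hom_ext (Representation.IntertwiningMap.ext (LinearMap.ext fun x => ?_))
  apply (Additive.toMul (α := (SemiLocal F E' v)ˣ)).injective
  refine Units.ext (funext fun w' => ?_)
  rfl

end SemiLocal

/-! ## §4. `Inf` on `Hⁿ(G, J)` is compatible with the place projections -/

namespace IdeleCohomology

open Literature.Algebra.Homology SemiLocal

variable {F E E' : Type} [Field F] [NumberField F] [Field E] [NumberField E] [Field E'] [NumberField E']
  [Algebra F E] [Algebra E E'] [Algebra F E'] [IsScalarTower F E E'] [Normal F E]
variable {v : HeightOneSpectrum (𝓞 F)}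

variable (E E') in
/-- **The semi-local inflation `Hⁿ(res, ι_v) : Hⁿ(Gal(E/F), ∏_{w∣v} E_wˣ) → Hⁿ(Gal(E'/F), ∏_{w'∣v} E'_{w'}ˣ)`.**
[cite: CasselsFrohlichANT1967, Ch. VII §7.2] -/
def semiLocalInf (v : HeightOneSpectrum (𝓞 F)) (n : ℕ) :
    groupCohomology (unitsRep F E v) n ⟶ groupCohomology (unitsRep F E' v) n :=
  groupCohomology.map (AlgEquiv.restrictNormalHom E) (inflRepHom E E' v) n

/-- **`Hⁿ(placeProj_{E'} v) ∘ Inf = Hⁿ(res, ι_v) ∘ Hⁿ(placeProj_E v)`** on `Hⁿ(Gal(E/F), J_E)`.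
[cite: CasselsFrohlichANT1967, Ch. VII §7.3] -/
theorem map_placeProj_comp_ideleInf (n : ℕ) :
    groupCohomology.map (MonoidHom.id (E ≃ₐ[F] E)) (A := IdeleClassGroup.ideleRep F E) (placeProj v) n ≫
        semiLocalInf E E' v n =
      ideleInf F E E' n ≫
        groupCohomology.map (MonoidHom.id (E' ≃ₐ[F] E')) (A := IdeleClassGroup.ideleRep F E') (placeProj v) n := by
  rw [semiLocalInf, ideleInf, ← groupCohomology.map_comp, ← groupCohomology.map_comp]
  exact map_congr' (by rw [MonoidHom.id_comp, MonoidHom.comp_id]) _ _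
    (fun x => congrArg (fun φ => φ.hom x) (res_placeProj_comp_inflRepHom (F := F) (E := E) (E' := E') (v := v))) n

/-- Element form: `Hⁿ(placeProj_{E'} v) (Inf c) = Hⁿ(res, ι_v) (Hⁿ(placeProj_E v) c)`.
[cite: CasselsFrohlichANT1967, Ch. VII §7.3] -/
theorem map_placeProj_ideleInf (n : ℕ) (c : groupCohomology (IdeleClassGroup.ideleRep F E) n) :
    groupCohomology.map (MonoidHom.id (E' ≃ₐ[F] E')) (placeProj (E := E') v) n (ideleInf F E E' n c) =
      semiLocalInf E E' v n (groupCohomology.map (MonoidHom.id (E ≃ₐ[F] E)) (placeProj (E := E) v) n c) :=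
  (congrArg (fun φ => φ c) (map_placeProj_comp_ideleInf (F := F) (E := E) (E' := E') (v := v) n)).symm

end IdeleCohomology

end Literature.NumberTheory.GaloisRepresentations

end
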